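import Mathlib.Algebra.Polynomial.Roots
import Mathlib.Algebra.Polynomial.FieldDivision
import Mathlib.FieldTheory.Separable
import Mathlib.FieldTheory.IsAlgClosed.Basic
import Mathlib.Algebra.CharP.Lemmas
import Mathlib.Algebra.CharP.Reduced
import Mathlib.Algebra.GCDMonoid.Finset
import Mathlib.Algebra.GCDMonoid.Nat
import Mathlib.Data.Nat.Factorization.Basic
import Mathlib.Data.Matrix.Basic
import HarnessLib

/-!
# Monomial one-parameter families of matrices closed under products are one-parameter groups
(trunk T-AUTOMORPHIC, G25 AutomorphicL; the algebraic core of the existence of root homomorphisms in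
positive characteristic, Springer, *Linear Algebraic Groups*, 2nd ed., 3.4.9 with 7.2.3, 7.3.3 (i),
8.1.1 (i))

Springer 8.1.1 (i) asserts, for a root `α` of a connected reductive group `G` relative to a maximal
torus `T` (algebraically closed ground field of *any* characteristic), the existence of an isomorphism
`u_α : 𝔾ₐ → U_α` onto a closed subgroup with `t u_α(x) t⁻¹ = u_α(α(t) x)`; the printed proof (7.3.3 (i)
with 7.2.3) takes `U_α` to be the unipotent part of a Borel subgroup of the rank-one group `G_α` and
invokes 3.4.9 (*a connected one-dimensional unipotent group is `𝔾ₐ`*, through Lazard's lemma on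
polynomial cocycles, 3.4.4–3.4.7). In characteristic `0` the tree obtains root homomorphisms from the
exponential (`NilpotentExpRootHom.lean`); in positive characteristic nothing was available. The route
taken in the tree (`HomogeneousUnipotentRootHom.lean`) replaces 3.4.9 by the torus action: once `T`
(diagonalised) acts transitively on `U ∖ {1}`, the group `U` is the *monomial family*
`u(c) = 1 + ∑_{N i j ≠ 0} c ^ {m i j} N i j E_{ij}` (`c ∈ k`) of a matrix `N` and positive integer
exponents `m` with `gcd = 1`, additive along products of matrix units
(`m i l + m l j = m i j`). This file proves the purely algebraic statement about such families:

* `monoFamily N m c` — the family; `IsMonoGroupFamily N m` — the hypotheses (exponents `≥ 1` on the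
  support of `N`, additive along the support, coprime, and **the family is closed under products**:
  `u(c) u(c') = u(F)` for some `F = F(c, c')`);
* **`IsMonoGroupFamily.mul_eq`** — then `u(c) u(c') = u(c + c')`: `u` is a homomorphism `𝔾ₐ → GLₙ`;
* **`IsMonoGroupFamily.exists_exponent_eq_one`** — and some exponent on the support equals `1`, so
  that a matrix entry is a *linear retraction* `u(c) ↦ c` (the "isomorphism onto a closed subgroup"
  clause of 8.1.1 (i), which in characteristic `p` excludes Frobenius twists).

Proof. Let `m₀` be the least exponent. Comparing the entries of exponent `m₀` in `u(c) u(c') = u(F)`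
gives `F ^ m₀ = c ^ m₀ + c' ^ m₀` (no cross terms by additivity and minimality); an entry of exponent
`m₁` gives `f(x) ^ m₁ = P₁(x)` for `f(x) = F(1, x)` and an explicit polynomial `P₁`, whence the
polynomial identity `(1 + X ^ m₀) ^ m₁ = P₁ ^ m₀`. Write `m₀ = p ^ e q` with `p ∤ q` (`q = m₀` in
characteristic `0`), so `1 + X ^ m₀ = (1 + X ^ q) ^ {p ^ e}` with `1 + X ^ q` separable: counting the
multiplicity of a root of `1 + X ^ q` on both sides gives `q ∣ m₁`. Hence `q` divides the `gcd`, `q = 1`,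
`m₀ = p ^ e`, and `F ^ {p^e} = (c + c') ^ {p ^ e}` forces `F = c + c'`. Finally, for the least exponent
`m₂` which is non-zero in `k`, the coefficient of `X ^ {m₂ - 1}` in the entry identity
`(X + 1) ^ m₂ = X ^ m₂ + 1 + ∑_l γ_l X ^ {m i l}` is `m₂ ≠ 0` on the left, so some `m i l = m₂ - 1` and
`m l j = 1`. No algebraic groups appear in this file; the consumer is `HomogeneousUnipotentRootHom.lean`.

## References

* [SpringerLAG1998] T. A. Springer, *Linear Algebraic Groups*, 2nd ed., Progress in Mathematics 9,
  Birkhäuser (1998): 3.4.9, 7.2.3, 7.3.3 (i), 8.1.1 (i).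
-/

noncomputable section

open Polynomial
open scoped Classical

namespace Literature.NumberTheory.Automorphic

variable {k : Type*} [Field k] {n : Type*} [Fintype n] [DecidableEq n]

/-! ### A multiplicity lemma: `(1 + X^q)^{E t} = P^{q E}` forces `q ∣ t` -/

/-- Root multiplicity of a power: `mult_x (g ^ s) = s · mult_x g`. [folklore] -/
theorem rootMultiplicity_pow_eq (g : k[X]) (x : k) (s : ℕ) :
    rootMultiplicity x (g ^ s) = s * rootMultiplicity x g := by
  by_cases hg : g = 0
  · subst hg
    cases s with
    | zero => simp
    | succ s => simp
  induction s with
  | zero => simp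
  | succ s ih =>
    rw [pow_succ, rootMultiplicity_mul (mul_ne_zero (pow_ne_zero _ hg) hg), ih]
    ring

/-- **If `(1 + X ^ q) ^ (E t) = P ^ (q E)` in `k[X]` with `q ≠ 0` in `k` and `E ≥ 1`, then `q ∣ t`**
(`k` algebraically closed): a root `ξ` of the separable polynomial `1 + X ^ q` has multiplicity
`E t` on the left and `q E · mult_ξ P` on the right. [folklore] -/
theorem dvd_of_one_add_X_pow_pow_eq [IsAlgClosed k] {q E t : ℕ} (hq : (q : k) ≠ 0) (hE : 1 ≤ E)
    {P : k[X]} (h : ((1 : k[X]) + X ^ q) ^ (E * t) = P ^ (q * E)) : q ∣ t := by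
  have hq0 : q ≠ 0 := by rintro rfl; exact hq (by simp)
  set g : k[X] := 1 + X ^ q with hgdef
  have hg' : g = X ^ q - C (-1) := by rw [hgdef, map_neg, map_one, sub_neg_eq_add, add_comm]
  have hgdeg : g.degree = q := by
    rw [hg', degree_X_pow_sub_C (Nat.pos_of_ne_zero hq0)]
  have hg0 : g ≠ 0 := by
    intro h0; rw [h0, degree_zero] at hgdeg; exact WithBot.bot_ne_natCast _ hgdeg
  obtain ⟨ξ, hξ⟩ := IsAlgClosed.exists_root g (by rw [hgdeg]; exact_mod_cast hq0)
  have hsep : g.Separable := by rw [hg']; exact separable_X_pow_sub_C (-1) hq (by simp)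
  have hmult : rootMultiplicity ξ g = 1 :=
    le_antisymm (rootMultiplicity_le_one_of_separable hsep ξ) ((rootMultiplicity_pos hg0).2 hξ)
  have hP0 : P ≠ 0 := by
    intro hP
    rw [hP, zero_pow (mul_ne_zero hq0 (by omega))] at h
    exact pow_ne_zero _ hg0 h
  have h1 := congrArg (rootMultiplicity ξ) h
  rw [rootMultiplicity_pow_eq, rootMultiplicity_pow_eq, hmult, mul_one] at h1
  -- `E * t = q * E * ν`
  refine ⟨rootMultiplicity ξ P, ?_⟩
  have hE0 : E ≠ 0 := by omega
  have : E * t = E * (q * rootMultiplicity ξ P) := by rw [h1]; ring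
  exact Nat.eq_of_mul_eq_mul_left (Nat.pos_of_ne_zero hE0) this

/-- **Splitting off the `p`-part of an exponent.** For `m₀ ≥ 1` there are `E ≥ 1` and `q` with
`q ≠ 0` in `k`, `m₀ = q E`, `(1 + X ^ q) ^ E = 1 + X ^ m₀` in `k[X]`, `(a + b) ^ E = a ^ E + b ^ E` and
`a ^ E = b ^ E → a = b` in `k`: in characteristic `0` take `E = 1`; in characteristic `p` write
`m₀ = p ^ e q` with `p ∤ q` and take `E = p ^ e` (Frobenius). [folklore] -/
theorem exists_pPart (m₀ : ℕ) (hm₀ : 1 ≤ m₀) :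
    ∃ E q : ℕ, 1 ≤ E ∧ (q : k) ≠ 0 ∧ m₀ = q * E ∧
      ((1 : k[X]) + X ^ q) ^ E = 1 + X ^ m₀ ∧
      (∀ a b : k, (a + b) ^ E = a ^ E + b ^ E) ∧ (∀ a b : k, a ^ E = b ^ E → a = b) := by
  obtain ⟨p, hp⟩ := CharP.exists k
  rcases CharP.char_is_prime_or_zero k p with hprime | rfl
  · haveI := Fact.mk hprime
    obtain ⟨e, q, hndvd, hm⟩ := Nat.exists_eq_pow_mul_and_not_dvd (by omega : m₀ ≠ 0) p hprime.ne_one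
    refine ⟨p ^ e, q, Nat.one_le_pow _ _ hprime.pos, ?_, by rw [hm, mul_comm], ?_, ?_, ?_⟩
    · rwa [Ne, CharP.cast_eq_zero_iff k p]
    · rw [add_pow_char_pow, one_pow, ← pow_mul, hm, mul_comm]
    · intro a b; exact add_pow_char_pow a b p e
    · intro a b hab
      have : (a - b) ^ p ^ e = 0 := by rw [sub_pow_char_pow, hab, sub_self]
      exact sub_eq_zero.1 (pow_eq_zero_iff (pow_ne_zero e hprime.ne_zero) |>.1 this)
  · haveI : CharZero k := CharP.charP_to_charZero k
    refine ⟨1, m₀, le_rfl, by exact_mod_cast (by omega : m₀ ≠ 0), by simp, by simp, fun a b => by simp,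
      fun a b h => by simpa using h⟩

/-! ### Monomial families -/

section Family

variable (N : Matrix n n k) (m : n × n → ℕ)

/-- The nilpotent-like part `E(c) i j = c ^ m (i, j) N i j` on the support of `N` (and `0` off it).
[folklore] -/
def monoE (c : k) : Matrix n n k :=
  Matrix.of fun i j => if N i j = 0 then 0 else c ^ m (i, j) * N i j

/-- The **monomial one-parameter family** `u(c) = 1 + ∑_{N i j ≠ 0} c ^ m (i, j) N i j E_{ij}` of a
matrix `N` with exponents `m` (the shape of a `T`-homogeneous one-parameter unipotent group in
coordinates diagonalising `T`, Springer 8.1.1 (i)). [folklore] -/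
def monoFamily (c : k) : Matrix n n k := 1 + monoE N m c

omit [Fintype n] [DecidableEq n] in
/-- Entries of `E(c)`. [folklore] -/
@[simp] lemma monoE_apply (c : k) (i j : n) :
    monoE N m c i j = if N i j = 0 then 0 else c ^ m (i, j) * N i j := rfl

/-- The support of `N`, as a finite set of index pairs. [folklore] -/
def monoSupport : Finset (n × n) := Finset.univ.filter fun s => N s.1 s.2 ≠ 0

omit [DecidableEq n] in
/-- Membership in the support. [folklore] -/
@[simp] lemma mem_monoSupport {s : n × n} : s ∈ monoSupport N ↔ N s.1 s.2 ≠ 0 := by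
  simp [monoSupport]

/-- **Hypotheses on a monomial family**: exponents at least `1` on the support, additive along the
support (`m i l + m l j = m i j`, the shadow of `χ_{il} χ_{lj} = χ_{ij}` for torus weights), of
`gcd` one on the support, and the family is closed under products. [folklore] -/
structure IsMonoGroupFamily : Prop where
  /-- `N ≠ 0`. -/
  ne_zero : N ≠ 0
  /-- Exponents on the support are positive. -/
  one_le : ∀ i j, N i j ≠ 0 → 1 ≤ m (i, j)
  /-- Additivity along the support. -/
  add_eq : ∀ i l j, N i l ≠ 0 → N l j ≠ 0 → N i j ≠ 0 → m (i, l) + m (l, j) = m (i, j)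
  /-- The exponents on the support are coprime. -/
  gcd_eq_one : (monoSupport N).gcd m = 1
  /-- Closure under products: `u(c) u(c') = u(F)` for some `F`. -/
  mul_mem : ∀ c c' : k, ∃ F : k, monoFamily N m c * monoFamily N m c' = monoFamily N m F

variable {N m}

omit [Fintype n] [DecidableEq n] in
/-- `E(0) = 0` when the exponents on the support are positive. [folklore] -/
lemma monoE_zero (h1 : ∀ i j, N i j ≠ 0 → 1 ≤ m (i, j)) : monoE N m (0 : k) = 0 := by
  ext i j
  simp only [monoE_apply, Matrix.zero_apply]
  split_ifs with hN
  · rfl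
  · rw [zero_pow (by have := h1 i j hN; omega), zero_mul]

omit [Fintype n] in
/-- `u(0) = 1`. [folklore] -/
lemma monoFamily_zero (h1 : ∀ i j, N i j ≠ 0 → 1 ≤ m (i, j)) : monoFamily N m (0 : k) = 1 := by
  rw [monoFamily, monoE_zero h1, add_zero]

/-- The product formula `u(c) u(c') = 1 + E(c) + E(c') + E(c) E(c')`. [folklore] -/
lemma monoFamily_mul (c c' : k) :
    monoFamily N m c * monoFamily N m c' = 1 + (monoE N m c + monoE N m c' + monoE N m c * monoE N m c') := by
  simp only [monoFamily, add_mul, mul_add, one_mul, mul_one]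
  abel

/-- **The entry identity.** If `u(c) u(c') = u(F)` then at a support entry `(i, j)`:
`F ^ m N = c ^ m N + c' ^ m N + ∑_l E(c) i l E(c') l j`. [folklore] -/
lemma entry_eq {c c' F : k} (hF : monoFamily N m c * monoFamily N m c' = monoFamily N m F)
    {i j : n} (hij : N i j ≠ 0) :
    F ^ m (i, j) * N i j = c ^ m (i, j) * N i j + c' ^ m (i, j) * N i j +
      ∑ l, monoE N m c i l * monoE N m c' l j := by
  rw [monoFamily_mul, monoFamily, add_right_inj] at hF
  have h := congrFun (congrFun hF i) j
  simp only [Matrix.add_apply, Matrix.mul_apply] at h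
  have key : ∀ a : k, monoE N m a i j = a ^ m (i, j) * N i j := fun a => by simp [hij]
  rw [key c, key c', key F] at h
  exact h.symm

/-- A cross term `E(c) i l E(c') l j` at a support entry `(i, j)`: either it vanishes or
`m i l + m l j = m i j` with both exponents `≥ 1`. [folklore] -/
lemma monoE_mul_monoE_apply (h : IsMonoGroupFamily N m) (c c' : k) (i l j : n) (hij : N i j ≠ 0) :
    monoE N m c i l * monoE N m c' l j = 0 ∨
      (N i l ≠ 0 ∧ N l j ≠ 0 ∧ m (i, l) + m (l, j) = m (i, j) ∧
        monoE N m c i l * monoE N m c' l j = c ^ m (i, l) * c' ^ m (l, j) * (N i l * N l j)) := by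
  by_cases hil : N i l = 0
  · left; simp [hil]
  by_cases hlj : N l j = 0
  · left; simp [hlj]
  right
  refine ⟨hil, hlj, h.add_eq i l j hil hlj hij, ?_⟩
  simp only [monoE_apply, if_neg hil, if_neg hlj]
  ring

end Family

/-! ### The least exponent `m₀`: `F ^ m₀ = c ^ m₀ + c' ^ m₀` -/

section Least

variable {N : Matrix n n k} {m : n × n → ℕ}

/-- The support is non-empty. [folklore] -/
lemma IsMonoGroupFamily.monoSupport_nonempty (h : IsMonoGroupFamily N m) : (monoSupport N).Nonempty := by
  by_contra hne
  rw [Finset.not_nonempty_iff_eq_empty] at hne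
  apply h.ne_zero
  ext i j
  by_contra hij
  have : (i, j) ∈ monoSupport N := by simpa using hij
  rw [hne] at this
  simp at this

/-- The least exponent on the support. [folklore] -/
def IsMonoGroupFamily.m₀ (h : IsMonoGroupFamily N m) : ℕ :=
  ((monoSupport N).image m).min' (h.monoSupport_nonempty.image m)

/-- `m₀` is attained on the support. [folklore] -/
lemma IsMonoGroupFamily.exists_eq_m₀ (h : IsMonoGroupFamily N m) : ∃ i j, N i j ≠ 0 ∧ m (i, j) = h.m₀ := by
  have hmem := Finset.min'_mem ((monoSupport N).image m) (h.monoSupport_nonempty.image m)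
  obtain ⟨⟨i, j⟩, hs, hm⟩ := Finset.mem_image.1 hmem
  exact ⟨i, j, by simpa using hs, hm⟩

/-- `m₀ ≤ m (i, j)` on the support. [folklore] -/
lemma IsMonoGroupFamily.m₀_le (h : IsMonoGroupFamily N m) {i j : n} (hij : N i j ≠ 0) : h.m₀ ≤ m (i, j) :=
  Finset.min'_le _ _ (Finset.mem_image.2 ⟨(i, j), by simpa using hij, rfl⟩)

/-- `1 ≤ m₀`. [folklore] -/
lemma IsMonoGroupFamily.one_le_m₀ (h : IsMonoGroupFamily N m) : 1 ≤ h.m₀ := by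
  obtain ⟨i, j, hij, hm⟩ := h.exists_eq_m₀
  rw [← hm]
  exact h.one_le i j hij

/-- **No cross terms at the least exponent**: at a support entry of exponent `m₀` all cross terms
`E(c) i l E(c') l j` vanish (else `m₀ = m i l + m l j ≥ m₀ + 1`). [folklore] -/
lemma IsMonoGroupFamily.sum_cross_eq_zero (h : IsMonoGroupFamily N m) (c c' : k) {i j : n}
    (hij : N i j ≠ 0) (hm : m (i, j) = h.m₀) :
    ∑ l, monoE N m c i l * monoE N m c' l j = 0 := by
  refine Finset.sum_eq_zero fun l _ => ?_
  rcases monoE_mul_monoE_apply h c c' i l j hij with h0 | ⟨hil, hlj, hadd, -⟩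
  · exact h0
  · exfalso
    have h1 := h.m₀_le hil
    have h2 := h.one_le l j hlj
    omega

/-- **`F ^ m₀ = c ^ m₀ + c' ^ m₀`** whenever `u(c) u(c') = u(F)`. [folklore] -/
theorem IsMonoGroupFamily.pow_m₀_eq (h : IsMonoGroupFamily N m) {c c' F : k}
    (hF : monoFamily N m c * monoFamily N m c' = monoFamily N m F) :
    F ^ h.m₀ = c ^ h.m₀ + c' ^ h.m₀ := by
  obtain ⟨i, j, hij, hm⟩ := h.exists_eq_m₀
  have he := entry_eq hF hij
  rw [h.sum_cross_eq_zero c c' hij hm, add_zero, ← add_mul, hm] at he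
  exact mul_right_cancel₀ hij he

end Least

/-! ### The entry polynomial at `c = 1` and the identity `(1 + X^{m₀})^{m₁} = P₁^{m₀}` -/

section EntryPoly

variable {N : Matrix n n k} {m : n × n → ℕ}

/-- The **entry polynomial** of a support entry `(i, j)`:
`P_{ij} = 1 + X ^ m (i, j) + N_{ij}⁻¹ ∑_l [N i l, N l j ≠ 0] N i l N l j X ^ m (l, j)`, so that
`f(x) ^ m (i, j) = P_{ij}(x)` when `u(1) u(x) = u(f(x))`. [folklore] -/
def entryPoly (N : Matrix n n k) (m : n × n → ℕ) (i j : n) : k[X] :=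
  1 + X ^ m (i, j) + C (N i j)⁻¹ *
    ∑ l, if N i l = 0 ∨ N l j = 0 then 0 else C (N i l * N l j) * X ^ m (l, j)

omit [DecidableEq n] in
/-- Evaluation of the entry polynomial reproduces the entry identity at `c = 1`. [folklore] -/
lemma eval_entryPoly (x : k) (i j : n) :
    (entryPoly N m i j).eval x =
      1 + x ^ m (i, j) + (N i j)⁻¹ * ∑ l, monoE N m 1 i l * monoE N m x l j := by
  simp only [entryPoly, eval_add, eval_one, eval_pow, eval_X, eval_mul, eval_C, eval_finsetSum]
  congr 1
  congr 1
  refine Finset.sum_congr rfl fun l _ => ?_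
  by_cases hil : N i l = 0
  · simp [hil]
  by_cases hlj : N l j = 0
  · simp [hlj]
  simp only [hil, hlj, or_self, if_false, eval_mul, eval_C, eval_pow, eval_X, monoE_apply, one_pow,
    one_mul]
  ring

/-- **`f(x) ^ m (i, j) = P_{ij}(x)`** when `u(1) u(x) = u(f(x))`. [folklore] -/
theorem pow_eq_eval_entryPoly {x f : k} (hf : monoFamily N m 1 * monoFamily N m x = monoFamily N m f)
    {i j : n} (hij : N i j ≠ 0) : f ^ m (i, j) = (entryPoly N m i j).eval x := by
  have he := entry_eq hf hij
  rw [one_pow, one_mul] at he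
  rw [eval_entryPoly x i j]
  have hN : N i j ≠ 0 := hij
  field_simp
  linear_combination he

/-- **The polynomial identity `(1 + X ^ m₀) ^ m (i, j) = P_{ij} ^ m₀`** for every support entry
(both sides evaluate at `x` to `f(x) ^ {m₀ m (i, j)}`; `k` is infinite). [folklore] -/
theorem IsMonoGroupFamily.one_add_X_pow_pow_eq [Infinite k] (h : IsMonoGroupFamily N m) {i j : n}
    (hij : N i j ≠ 0) :
    ((1 : k[X]) + X ^ h.m₀) ^ m (i, j) = (entryPoly N m i j) ^ h.m₀ := by
  refine Polynomial.funext fun x => ?_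
  obtain ⟨f, hf⟩ := h.mul_mem 1 x
  have h1 : f ^ h.m₀ = 1 + x ^ h.m₀ := by rw [h.pow_m₀_eq hf, one_pow]
  have h2 : f ^ m (i, j) = (entryPoly N m i j).eval x := pow_eq_eval_entryPoly hf hij
  rw [eval_pow, eval_pow, eval_add, eval_one, eval_pow, eval_X, ← h1, ← h2, ← pow_mul, ← pow_mul,
    mul_comm]

end EntryPoly

/-! ### Conclusion: additivity and an exponent equal to one -/

section Conclusion

variable {N : Matrix n n k} {m : n × n → ℕ}

/-- **`m₀` is a power of the characteristic exponent**: with `m₀ = q E` as in `exists_pPart`, one has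
`q = 1`, because `q` divides every exponent on the support (multiplicity count in
`(1 + X ^ m₀) ^ {m (i,j)} = P_{ij} ^ m₀`), hence their `gcd = 1`. [folklore] -/
theorem IsMonoGroupFamily.exists_m₀_eq [IsAlgClosed k] (h : IsMonoGroupFamily N m) :
    ∃ E : ℕ, 1 ≤ E ∧ h.m₀ = E ∧ (∀ a b : k, (a + b) ^ E = a ^ E + b ^ E) ∧
      (∀ a b : k, a ^ E = b ^ E → a = b) := by
  obtain ⟨E, q, hE, hq, hm₀, hfrob, hadd, hinj⟩ := exists_pPart (k := k) h.m₀ h.one_le_m₀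
  have hqdvd : ∀ s ∈ monoSupport N, q ∣ m s := by
    rintro ⟨i, j⟩ hs
    have hij : N i j ≠ 0 := by simpa using hs
    have hid := h.one_add_X_pow_pow_eq hij
    rw [← hfrob, ← pow_mul, hm₀] at hid
    exact dvd_of_one_add_X_pow_pow_eq hq hE hid
  have hq1 : q = 1 := by
    have := Finset.dvd_gcd hqdvd
    rw [h.gcd_eq_one] at this
    exact Nat.dvd_one.1 this
  refine ⟨E, hE, by rw [hm₀, hq1, one_mul], hadd, hinj⟩

/-- **A product-closed monomial family is additive: `u(c) u(c') = u(c + c')`.** From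
`F ^ m₀ = c ^ m₀ + c' ^ m₀ = (c + c') ^ m₀` (`m₀` a power of the characteristic exponent) and the
injectivity of `a ↦ a ^ m₀`. [cite: SpringerLAG1998, 8.1.1 (i) (proof) with 3.4.9] -/
theorem IsMonoGroupFamily.mul_eq [IsAlgClosed k] (h : IsMonoGroupFamily N m) (c c' : k) :
    monoFamily N m c * monoFamily N m c' = monoFamily N m (c + c') := by
  obtain ⟨F, hF⟩ := h.mul_mem c c'
  obtain ⟨E, -, hm₀E, hadd, hinj⟩ := h.exists_m₀_eq
  have hpow := h.pow_m₀_eq hF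
  rw [hm₀E, ← hadd] at hpow
  rw [hF, hinj _ _ hpow]

/-- The least exponent which is non-zero in `k` exists (some exponent is prime to the
characteristic, the `gcd` being `1`). [folklore] -/
lemma IsMonoGroupFamily.exists_cast_ne_zero (h : IsMonoGroupFamily N m) :
    ∃ i j, N i j ≠ 0 ∧ (m (i, j) : k) ≠ 0 := by
  obtain ⟨p, hp⟩ := CharP.exists k
  by_contra hcon
  push Not at hcon
  have hpdvd : ∀ s ∈ monoSupport N, p ∣ m s := by
    rintro ⟨i, j⟩ hs
    have hij : N i j ≠ 0 := by simpa using hs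
    exact (CharP.cast_eq_zero_iff k p _).1 (hcon i j hij)
  have := Finset.dvd_gcd hpdvd
  rw [h.gcd_eq_one, Nat.dvd_one] at this
  subst this
  have h1 := CharP.cast_eq_zero k 1
  exact one_ne_zero (Nat.cast_one.symm.trans h1)

/-- The entry identity at `c' = 1` as a polynomial identity in `c`, for an additive family:
`N ((X + 1) ^ m (i, j) - X ^ m (i, j) - 1) = ∑_l [N i l, N l j ≠ 0] N i l N l j X ^ m (i, l)`.
[folklore] -/
lemma IsMonoGroupFamily.entry_poly_eq [IsAlgClosed k] (h : IsMonoGroupFamily N m) {i j : n}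
    (hij : N i j ≠ 0) :
    C (N i j) * ((X + 1) ^ m (i, j) - X ^ m (i, j) - 1) =
      ∑ l, if N i l = 0 ∨ N l j = 0 then 0 else C (N i l * N l j) * X ^ m (i, l) := by
  refine Polynomial.funext fun c => ?_
  have he := entry_eq (h.mul_eq c 1) hij
  simp only [eval_mul, eval_C, eval_sub, eval_pow, eval_add, eval_X, eval_one, eval_finsetSum]
  have hsum : ∑ l, monoE N m c i l * monoE N m 1 l j =
      ∑ l, (if N i l = 0 ∨ N l j = 0 then 0 else C (N i l * N l j) * X ^ m (i, l)).eval c := by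
    refine Finset.sum_congr rfl fun l _ => ?_
    by_cases hil : N i l = 0
    · simp [hil]
    by_cases hlj : N l j = 0
    · simp [hlj]
    simp only [monoE_apply, hil, hlj, or_self, if_false, eval_mul, eval_C,
      eval_pow, eval_X, one_pow, one_mul]
    ring
  rw [← hsum]
  linear_combination he

/-- **Some exponent on the support equals `1`.** Let `m₂` be the least exponent on the support which
is non-zero in `k`; if `m₂ ≥ 2`, the coefficient of `X ^ (m₂ - 1)` in the entry identity is
`m₂ N i j ≠ 0` on the left, so some cross term has `m i l = m₂ - 1`, whence `m l j = 1`. This is the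
point where a monomial family is seen to carry a linear retraction `u(c) ↦ c`.
[cite: SpringerLAG1998, 8.1.1 (i) (proof) with 3.4.9] -/
theorem IsMonoGroupFamily.exists_exponent_eq_one [IsAlgClosed k] (h : IsMonoGroupFamily N m) :
    ∃ i j, N i j ≠ 0 ∧ m (i, j) = 1 := by
  classical
  -- the least exponent non-zero in `k`
  set S₂ : Finset (n × n) := (monoSupport N).filter fun s => (m s : k) ≠ 0 with hS₂
  have hS₂ne : S₂.Nonempty := by
    obtain ⟨i, j, hij, hm⟩ := h.exists_cast_ne_zero
    exact ⟨(i, j), Finset.mem_filter.2 ⟨by simpa using hij, hm⟩⟩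
  set m₂ : ℕ := (S₂.image m).min' (hS₂ne.image m) with hm₂
  obtain ⟨⟨i, j⟩, hs, hmij⟩ := Finset.mem_image.1 (Finset.min'_mem (S₂.image m) (hS₂ne.image m))
  rw [← hm₂] at hmij
  obtain ⟨hij', hcast⟩ := Finset.mem_filter.1 hs
  have hij : N i j ≠ 0 := by simpa using hij'
  have hm₂le : ∀ i' j', N i' j' ≠ 0 → (m (i', j') : k) ≠ 0 → m₂ ≤ m (i', j') := fun i' j' h1 h2 =>
    Finset.min'_le _ _ (Finset.mem_image.2 ⟨(i', j'), Finset.mem_filter.2 ⟨by simpa using h1, h2⟩, rfl⟩)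
  by_cases h1 : m (i, j) = 1
  · exact ⟨i, j, hij, h1⟩
  -- `m (i, j) = m₂ ≥ 2`: compare coefficients of `X ^ (m₂ - 1)`
  have hge : 2 ≤ m (i, j) := by have := h.one_le i j hij; omega
  have hid := congrArg (fun P : k[X] => P.coeff (m (i, j) - 1)) (h.entry_poly_eq hij)
  simp only [coeff_C_mul, finsetSum_coeff] at hid
  have hL : ((X + 1 : k[X]) ^ m (i, j) - X ^ m (i, j) - 1).coeff (m (i, j) - 1) = (m (i, j) : k) := by
    rw [coeff_sub, coeff_sub, coeff_X_add_one_pow, coeff_X_pow, coeff_one]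
    rw [if_neg (by omega), if_neg (by omega), sub_zero, sub_zero,
      Nat.choose_symm (by omega : 1 ≤ m (i, j)), Nat.choose_one_right]
  rw [hL] at hid
  -- the left side is non-zero
  have hne : N i j * (m (i, j) : k) ≠ 0 := mul_ne_zero hij (by rw [hmij]; rw [hmij] at hcast; exact hcast)
  rw [hid] at hne
  obtain ⟨l, -, hl⟩ := Finset.exists_ne_zero_of_sum_ne_zero hne
  by_cases hil : N i l = 0
  · simp [hil] at hl
  by_cases hlj : N l j = 0
  · simp [hlj] at hl
  simp only [hil, hlj, or_self, if_false, coeff_C_mul, coeff_X_pow, mul_ite, mul_one, mul_zero,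
    ne_eq, ite_eq_right_iff, Classical.not_imp] at hl
  obtain ⟨heq, -⟩ := hl
  -- `m (i, l) = m (i, j) - 1`, so `m (l, j) = 1`
  have hadd := h.add_eq i l j hil hlj hij
  exact ⟨l, j, hlj, by omega⟩

end Conclusion

end Literature.NumberTheory.Automorphic

end
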